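import Summits.ResolutionOfSingularities.ResolutionOfSingularities.Theorems.TauChainCutCells
import HarnessLib

/-!
# TauChainCutCells2 — decomp-res node «TauChainCut» (lens-4 g32 REV 2, critic row 186 CLEARED DECIDED +1 · MAP 0),
tree file 4/5 of the node

Content VERBATIM from the decomp-res lens-4 g32 node REV 2 `HOME/decomp-res-lens-4/g32/TauChainCut_rev2.lean` (pin
d70c0cc0; imports the landed tree only, carries nothing); HOME = run/shared/lean/pub/decomp-res; critic row 186
CLEARED DECIDED +1 · MAP 0; landing orders INBOX :984/:996 — provenance, critic text and the lens header in full in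
the first file of the node, `TauChainLaw`.  Namespace `…Theorems.HugValuationCut`; `--supports
stmt-ResolutionOfSingularities-28338`.

## This file

Continuation 2/2 of `TauChainCutCells` (same sections of the node, cut at the 400-line cap): carries
`NoWildMixedWallFreeFreshJumpShallowCompanionKangarooTowers`, `noWildSteepThreefoldTowers_holds`,
`noWildPrincipalThreefoldNonSurfaceTowers_holds`, `noWildCurveLikeThreefoldTowers_holds`,
`noWildNonSurfaceWallFreeFreshJumpShallowCompanionKangarooTowers_iff_cells`,
`noWildNonSurfaceWallFreeFreshJumpShallowCompanionKangarooTowers_iff_g32`,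
`noWildWallFreeFreshJumpShallowCompanionKangarooTowers_iff_g32`,
`noWildFreshJumpShallowCompanionKangarooTowers_iff_g32`, `noWildFreeJumpShallowCompanionKangarooTowers_iff_g32`,
`noWildShallowCompanionKangarooTowers_iff_g32`, `noWildCompanionKangarooTowers_iff_g32`,
`noWildMixedWallFreeFreshJumpShallowCompanionKangarooTowers_of_g31`,
`noWildMixedWallFreeFreshJumpShallowCompanionKangarooTowers_of_g30`,
`noWildMixedWallFreeFreshJumpShallowCompanionKangarooTowers_of_aside`,
`noTowerWild_contactFreeOffLocus_steep_and_curveLike`,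
`tau_entrance_imperfect_chart`, `tau_entrance_composite_chart`, `mixed_entrance_chart`.

[WRITER NOTE (decomp-res writer g12): file split only (tree files ≤ 400 lines); ONE lens declaration is NOT landed —
the §97 alias `noTowerWild_contactFreeOffLocus_principalThreefold_of_port (h640) (hn) (P)`, whose statement and
proof are literally the §95 theorem `noTowerWild_principalThreefold_of_port h640 hn P` (landed in
`TauChainCutCells`): the gate's `dedup.landed` refuses restatements of landed declarations (bounce p813947), so cite
`noTowerWild_principalThreefold_of_port` wherever the lens names the alias (no tree file uses it); namespace, sections, section
variables / opens and every declaration exactly as in the lens (the node's global dupNamespace-linter line is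
dropped — the library sets it; the `open …Theses` line lives only in the Theses-cone file
`MaxContactCutTauChainCut`; the lens's cone imports `MaxContactCutSatelliteCut` / `MaxContactCutWallCutCells` /
`MaxContactCutSurfacePort` are confined to the cone file, the cone-free files import `SurfacePort` /
`SurfacePortCells` (⊇ the Wall / History / Depth cut cells they open) per rider (1)–(2)).]

(Sources: Hironaka1964 Ch. III (τ, directrix); Hironaka1970 / Giraud1975 (near points, τ-monotonicity);
CossartJannsenSaito2020 Thm. 6.40, Def. 6.38–6.39, Thm. 6.35 / Cor. 6.37, Ch. 8; Hauser2010Kangaroo;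
HauserPerlega2019 §2; CossartPiltant2008 §2; CossartPiltant2019; Hironaka2005; Matsumura1987 §28; StacksProject 0804
/ 0BIQ / 031I.)
-/

noncomputable section

open CategoryTheory AlgebraicGeometry IsLocalRing TopologicalSpace
open Literature.AlgebraicGeometry.Resolution
open Summit.ResolutionOfSingularities.ResolutionOfSingularities.Theorems
open WeakOrderReduction ForcedTowerClasses DivergentTowerClasses MonomialTowerClasses
open HugDimensionClasses HugDimensionKernels SurfaceShadowClasses SurfaceShadowKernels
open NearPointCut (SingularClass)
open Scheme.IdealSheafData (vanishingIdeal)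
open scoped BigOperators

namespace Summit.ResolutionOfSingularities.ResolutionOfSingularities.Theorems.HugValuationCut

section CurveCells

variable {k : Type} [Field k]

/-- BY NAME: **no wild MIXED wall-free fresh-jumping shallow companion-recurrent tower** — THE LOCATED RESIDUAL of
the aside chain
`NoWildContactFreeOffLocusTowers ⊇ … ⊇ NoWildNonSurfaceWallFreeFreshJumpShallowCompanionKangarooTowers ⊇ ·` after
g32 (CELL 3b). -/
def NoWildMixedWallFreeFreshJumpShallowCompanionKangarooTowers : Prop :=
  ∀ n : ℕ, 1 ≤ n → WildMixedWallFreeFreshJumpShallowCompanionKangarooTowersTerminate n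

/-- **CELL 1 DECIDED BY NAME (kernel).** [folklore] -/
theorem noWildSteepThreefoldTowers_holds : NoWildSteepThreefoldTowers := fun _ hn => wildSteepThreefoldWallFree_holds hn

/-- **CELL 2 DECIDED BY NAME (kernel).** [folklore] -/
theorem noWildPrincipalThreefoldNonSurfaceTowers_holds : NoWildPrincipalThreefoldNonSurfaceTowers := fun _ hn =>
  wildPrincipalThreefoldNonSurfaceWallFree_holds hn

/-- **CELL 3a DECIDED BY NAME (kernel).** [folklore] -/
theorem noWildCurveLikeThreefoldTowers_holds : NoWildCurveLikeThreefoldTowers := fun _ hn =>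
  wildCurveLikeThreefoldWallFree_holds hn

/-- **EXACT BY NAME as a conjunction of the four cells, HYPOTHESIS-FREE.** [folklore] -/
theorem noWildNonSurfaceWallFreeFreshJumpShallowCompanionKangarooTowers_iff_cells :
    NoWildNonSurfaceWallFreeFreshJumpShallowCompanionKangarooTowers ↔
      NoWildSteepThreefoldTowers ∧ NoWildPrincipalThreefoldNonSurfaceTowers ∧ NoWildCurveLikeThreefoldTowers ∧
        NoWildMixedWallFreeFreshJumpShallowCompanionKangarooTowers :=
  ⟨fun h => ⟨fun n hn => ((wildNonSurfaceWallFreeFreshJumpShallow_split_cells n).mp (h n hn)).1,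
      fun n hn => ((wildNonSurfaceWallFreeFreshJumpShallow_split_cells n).mp (h n hn)).2.1,
      fun n hn => ((wildNonSurfaceWallFreeFreshJumpShallow_split_cells n).mp (h n hn)).2.2.1,
      fun n hn => ((wildNonSurfaceWallFreeFreshJumpShallow_split_cells n).mp (h n hn)).2.2.2⟩,
    fun h n hn => (wildNonSurfaceWallFreeFreshJumpShallow_split_cells n).mpr
      ⟨h.1 n hn, h.2.1 n hn, h.2.2.1 n hn, h.2.2.2 n hn⟩⟩

/-- **EXACT RE-LOCATION BY NAME, HYPOTHESIS-FREE: THE TARGET (g31 residual) ⟺ THE MIXED RESIDUAL.** [folklore] -/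
theorem noWildNonSurfaceWallFreeFreshJumpShallowCompanionKangarooTowers_iff_g32 :
    NoWildNonSurfaceWallFreeFreshJumpShallowCompanionKangarooTowers ↔ NoWildMixedWallFreeFreshJumpShallowCompanionKangarooTowers :=
  ⟨fun h n hn => (wildNonSurfaceWallFreeFreshJumpShallow_iff_g32 hn).mp (h n hn),
    fun h n hn => (wildNonSurfaceWallFreeFreshJumpShallow_iff_g32 hn).mpr (h n hn)⟩

/-- **GIVEN THE PORT: the g30 residual ⟺ the mixed residual.** [folklore] -/
theorem noWildWallFreeFreshJumpShallowCompanionKangarooTowers_iff_g32 (h640 : SurfaceChainPort) :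
    NoWildWallFreeFreshJumpShallowCompanionKangarooTowers ↔ NoWildMixedWallFreeFreshJumpShallowCompanionKangarooTowers :=
  (noWildWallFreeFreshJumpShallowCompanionKangarooTowers_iff_g31 h640).trans
    noWildNonSurfaceWallFreeFreshJumpShallowCompanionKangarooTowers_iff_g32

/-- **GIVEN THE PORT: the g29 residual ⟺ the mixed residual.** [folklore] -/
theorem noWildFreshJumpShallowCompanionKangarooTowers_iff_g32 (h640 : SurfaceChainPort) :
    NoWildFreshJumpShallowCompanionKangarooTowers ↔ NoWildMixedWallFreeFreshJumpShallowCompanionKangarooTowers :=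
  (noWildFreshJumpShallowCompanionKangarooTowers_iff_g31 h640).trans
    noWildNonSurfaceWallFreeFreshJumpShallowCompanionKangarooTowers_iff_g32

/-- **GIVEN THE PORT: the g28 residual ⟺ the mixed residual.** [folklore] -/
theorem noWildFreeJumpShallowCompanionKangarooTowers_iff_g32 (h640 : SurfaceChainPort) :
    NoWildFreeJumpShallowCompanionKangarooTowers ↔ NoWildMixedWallFreeFreshJumpShallowCompanionKangarooTowers :=
  (noWildFreeJumpShallowCompanionKangarooTowers_iff_g31 h640).trans
    noWildNonSurfaceWallFreeFreshJumpShallowCompanionKangarooTowers_iff_g32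

/-- **GIVEN THE PORT: the g27 residual ⟺ the mixed residual.** [folklore] -/
theorem noWildShallowCompanionKangarooTowers_iff_g32 (h640 : SurfaceChainPort) :
    NoWildShallowCompanionKangarooTowers ↔ NoWildMixedWallFreeFreshJumpShallowCompanionKangarooTowers :=
  (noWildShallowCompanionKangarooTowers_iff_g31 h640).trans noWildNonSurfaceWallFreeFreshJumpShallowCompanionKangarooTowers_iff_g32

/-- **GIVEN THE PORT: the g26 residual ⟺ the mixed residual.** [folklore] -/
theorem noWildCompanionKangarooTowers_iff_g32 (h640 : SurfaceChainPort) :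
    NoWildCompanionKangarooTowers ↔ NoWildMixedWallFreeFreshJumpShallowCompanionKangarooTowers :=
  (noWildCompanionKangarooTowers_iff_g31 h640).trans noWildNonSurfaceWallFreeFreshJumpShallowCompanionKangarooTowers_iff_g32

/-- up-link (hypothesis-free): the g32 residual ⟸ the g31 residual (THE TARGET). [folklore] -/
theorem noWildMixedWallFreeFreshJumpShallowCompanionKangarooTowers_of_g31
    (h : NoWildNonSurfaceWallFreeFreshJumpShallowCompanionKangarooTowers) :
    NoWildMixedWallFreeFreshJumpShallowCompanionKangarooTowers :=
  noWildNonSurfaceWallFreeFreshJumpShallowCompanionKangarooTowers_iff_g32.mp h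

/-- up-link (hypothesis-free): the g32 residual ⟸ the g30 residual. [folklore] -/
theorem noWildMixedWallFreeFreshJumpShallowCompanionKangarooTowers_of_g30 (h : NoWildWallFreeFreshJumpShallowCompanionKangarooTowers) :
    NoWildMixedWallFreeFreshJumpShallowCompanionKangarooTowers :=
  noWildMixedWallFreeFreshJumpShallowCompanionKangarooTowers_of_g31
    (noWildNonSurfaceWallFreeFreshJumpShallowCompanionKangarooTowers_of_g30 h)

/-- up-link from the TREE aside `NoWildContactFreeOffLocusTowers` (hypothesis-free). [folklore] -/
theorem noWildMixedWallFreeFreshJumpShallowCompanionKangarooTowers_of_aside (h : NoWildContactFreeOffLocusTowers) :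
    NoWildMixedWallFreeFreshJumpShallowCompanionKangarooTowers :=
  noWildMixedWallFreeFreshJumpShallowCompanionKangarooTowers_of_g31
    (noWildNonSurfaceWallFreeFreshJumpShallowCompanionKangarooTowers_of_aside h)

/-- **THE STEEP-THREEFOLD AND CURVE-LIKE-THREEFOLD CUTS OF THE WHOLE TREE ASIDE (KERNEL, class-generic, no port).**
[folklore] -/
theorem noTowerWild_contactFreeOffLocus_steep_and_curveLike {n : ℕ} (hn : 1 ≤ n) (P : ForcedTower → Prop) :
    (NoTowerWild n fun T => P T ∧ SteepThreefold n T) ∧ NoTowerWild n fun T => P T ∧ (ThreefoldTower T ∧ CurveLikeTower T) :=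
  ⟨noTowerWild_steepThreefold hn P, noTowerWild_curveLikeThreefold hn P⟩

end CurveCells

section TauEntrances

variable {R : Type*} [CommRing R]

/-! ## §98 (g32 · ENTRANCE CERTIFICATES) kernel-checked chart identities of the finite profiles quoted in the cells' docstrings
(standard monomial substitutions of the point blow-up; identities over every commutative ring). -/

/-- (R′3) the IMPERFECT-RESIDUE `τ = 2` profile `z² + t·x² + u⁷` — `u`-chart `z ↦ zu, x ↦ xu`: total transform
`u²·(z² + t·x² + u⁵)`,
then `u²·(z² + t·x² + u³)`, then `u²·(z² + t·x² + u)` (order 1: the chain of near points stops). [folklore] -/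
theorem tau_entrance_imperfect_chart (t x z u : R) :
    (z * u) ^ 2 + t * (x * u) ^ 2 + u ^ 7 = u ^ 2 * (z ^ 2 + t * x ^ 2 + u ^ 5) ∧
      (z * u) ^ 2 + t * (x * u) ^ 2 + u ^ 5 = u ^ 2 * (z ^ 2 + t * x ^ 2 + u ^ 3) ∧
        (z * u) ^ 2 + t * (x * u) ^ 2 + u ^ 3 = u ^ 2 * (z ^ 2 + t * x ^ 2 + u) := by
  refine ⟨by ring, by ring, by ring⟩

/-- (R′3′) the COMPOSITE-WEIGHT `τ = 2` profile `x²u² + z⁵ + x⁷ + u⁷` (weight 4) — `u`-chart `x ↦ xu, z ↦ zu`: total transform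
`u⁴·(x² + z⁵u + x⁷u³ + u³)`, of order `2 < 4` at every point of the exceptional divisor: NO near point. [folklore] -/
theorem tau_entrance_composite_chart (x z u : R) :
    (x * u) ^ 2 * u ^ 2 + (z * u) ^ 5 + (x * u) ^ 7 + u ^ 7 = u ^ 4 * (x ^ 2 + z ^ 5 * u + x ^ 7 * u ^ 3 + u ^ 3) := by
  ring

/-- (M1) the MIXED profile `𝓘 = (x², xy³, xu³) = x·(x, y³, u³)` — `u`-chart `x ↦ xu, y ↦ yu`: the total transforms
of the three generators
are `u²·x²`, `u²·(xy³u²)`, `u²·(xu²)`, so the weight-2 controlled transform is `(x², xy³u², xu²) = x·(x, y³u², u²)`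
— again mixed (divisorial
part `V(x)`) of order 2 at the origin. [folklore] -/
theorem mixed_entrance_chart (x y u : R) :
    (x * u) ^ 2 = u ^ 2 * x ^ 2 ∧ (x * u) * (y * u) ^ 3 = u ^ 2 * (x * y ^ 3 * u ^ 2) ∧ (x * u) * u ^ 3 = u ^ 2 * (x * u ^ 2) := by
  refine ⟨by ring, by ring, by ring⟩

end TauEntrances

end Summit.ResolutionOfSingularities.ResolutionOfSingularities.Theorems.HugValuationCut
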